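import Summits.CriticalPhenomena.SAWScalingLimit.Theorems.SAWDevelopingMapObservableToSLETypeLadderCarvedReductionSqueezeGateBounds
import Summits.CriticalPhenomena.SAWScalingLimit.Theorems.SAWDefectDecoherenceObservableToSLERNestedGateDefs
import Literature.Probability.RandomPlanarGeometry.HexSAW
import HarnessLib

/-!
# What a realised first good gate gives: the gate edge, the clean window ball, locality of the
# pinned gate, `ρ ≤ R`, and the window balls in the closure of the pinned limit domain
# (piece (T-A′ facts) of stub T-A′ `stub_carvedReduction_squeezeGeometry_domains`)

Crux `SAWDevelopingMap.ObservableToSLE` (stmt-CriticalPhenomena-10472), line `six-class-type-ladder`,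
stub T-A′ `stub_carvedReduction_squeezeGeometry_domains`.  Landing target:
`Summits/CriticalPhenomena/SAWScalingLimit/Theorems/SAWDevelopingMapObservableToSLETypeLadderCarvedReductionSqueezeGateFacts.lean`
(`--supports stmt-CriticalPhenomena-10472`; registered carrier `stub_carvedReduction_gateFacts`).

Unpacking of the hypothesis `hgates` of T-A′ (a realised self-avoiding walk `γ` with FIRST GOOD
GATES `IsFirstGoodGateN` for `S` along its vertex list and for `T` along the reversed list) into
the elementary facts the assembly of the outer super-domain uses:

* `firstGoodGateN_facts` — `p ∈ S n`, the gate edge `p ~ q` in the honeycomb lattice (consecutive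
  entries of the walk), the clean window ball `closedBall (δ c_q) ρ ⊆ Ω`, the first-exit data and
  "never returns" (the inputs of `exists_middleWalk`);
* `dist_gate_root_le` — the rescaled gate is within `R + δ` of the rescaled root
  (`dist_le_of_adj_mem` with the locality clause of `TameNestedFamily`);
* `dist_limit_gate_root_le`, `rho_le_R` — in the limit `|P + τ - D.pt 0| ≤ R`, and `ρ ≤ R` (the
  clean ball `closedBall (s_j c_{q_j}) ρ ⊆ D` stays off `D.pt 0 ∈ ∂D`);
* `ball_subset_closure_pinned` — the pinned window balls lie in `closure (D - τ)`
  (from `closedBall (Pᵢ + τ_j) (ρ/2) ⊆ D` eventually and `τ_j → τ`);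
* `stub_carvedReduction_gateFacts` — registered packaging of the first two items.
-/

noncomputable section

open scoped Topology
open Filter Set Metric
open Literature.Probability.LatticeModels (HexVertex hexGraph hexCenter triEmbed Site)
open Literature.Probability.RandomPlanarGeometry
open Literature.Probability.RandomPlanarGeometry.SAW

namespace Summit.CriticalPhenomena.SAWScalingLimit.Theorems.ObservableToSLE.TypeLadder

open Summit.CriticalPhenomena.SAWScalingLimit.Theorems.ObservableToSLER.BridgeGate (HasCleanWindow)
open Summit.CriticalPhenomena.SAWScalingLimit.Theorems.ObservableToSLER.NestedGate

/-- **What a first good gate of a walk gives.** -/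
theorem firstGoodGateN_facts {Ω : Set ℂ} {δ ρ R : ℝ} {S : ℕ → Set HexVertex} {c a b : HexVertex}
    (w : (hexDomainGraph Ω δ).Walk a b) {n m : ℕ} {p q : HexVertex}
    (h : IsFirstGoodGateN Ω δ ρ R S c w.support n m p q) :
    p ∈ S n ∧ hexGraph.Adj p q ∧ closedBall ((δ : ℂ) * hexCenter q) ρ ⊆ Ω ∧
      IsFirstExitFrom (S n) w.support m p q ∧ (∀ v ∈ w.support.drop m, v ∉ S n) := by
  obtain ⟨⟨hexit, hnoret, hclean, -⟩, -⟩ := h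
  obtain ⟨hp, hq, htake, -⟩ := hexit
  refine ⟨htake p (List.mem_of_getLast? hp), ?_, hclean.1, ⟨hp, hq, htake, hexit_q⟩, hnoret⟩
  -- the gate edge: `p = l[m-1]`, `q = l[m]`, consecutive vertices of the walk
  · set l := w.support with hl
    have hlen : l.length = w.length + 1 := w.length_support
    rw [List.head?_drop] at hq
    obtain ⟨hm, hlm⟩ := List.getElem?_eq_some_iff.1 hq
    rw [List.getLast?_take] at hp
    have hm0 : m ≠ 0 := by rintro rfl; simp at hp
    rw [if_neg hm0] at hp
    have hm1 : m - 1 < l.length := by omega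
    rw [List.getElem?_eq_getElem hm1, Option.some_or] at hp
    have hlp : l[m - 1] = p := Option.some_injective _ hp
    have hadj := w.adj_getVert_succ (i := m - 1) (by rw [hlen] at hm; omega)
    rw [show m - 1 + 1 = m by omega, w.getVert_eq_support_getElem (by rw [hlen] at hm1; omega),
      w.getVert_eq_support_getElem (by rw [hlen] at hm; omega)] at hadj
    simp only [← hl] at hadj
    rw [hlp, hlm] at hadj
    exact embDomainGraph_le hexGraph hexCenter Ω δ hadj
  where
    hexit_q : q ∉ S n := by
      obtain ⟨⟨⟨-, -, -, hq⟩, -⟩, -⟩ := h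
      exact hq

/-- **The rescaled gate is within `R + δ` of the rescaled root.** -/
theorem dist_gate_root_le {Ω : Set ℂ} {δ ρ R : ℝ} {N : ℕ} (hδ : 0 ≤ δ) {S : ℕ → Set HexVertex} {c a b : HexVertex}
    (w : (hexDomainGraph Ω δ).Walk a b) {n m : ℕ} {p q : HexVertex}
    (h : IsFirstGoodGateN Ω δ ρ R S c w.support n m p q) (hS : TameNestedFamily δ R N c S) :
    dist ((δ : ℂ) * hexCenter q) ((δ : ℂ) * hexCenter c) ≤ R + δ := by
  obtain ⟨hp, hpq, -, -, -⟩ := firstGoodGateN_facts w h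
  exact dist_le_of_adj_mem hδ (hS.2.2.1 n) hp hpq

/-- **In the limit the pinned gate is within `R` of the root**: if `s_j → 0⁺`, `s_j c_{q_j} → Q` and
`s_j c_{c_j} → α` with `dist (s_j c_{q_j}) (s_j c_{c_j}) ≤ R + s_j`, then `dist Q α ≤ R`. -/
theorem dist_limit_gate_root_le {s : ℕ → ℝ} {u v : ℕ → ℂ} {Q α : ℂ} {R : ℝ}
    (hs0 : Tendsto s atTop (𝓝 0)) (hu : Tendsto u atTop (𝓝 Q)) (hv : Tendsto v atTop (𝓝 α))
    (hd : ∀ j, dist (u j) (v j) ≤ R + s j) : dist Q α ≤ R := by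
  have h1 : Tendsto (fun j => dist (u j) (v j)) atTop (𝓝 (dist Q α)) := hu.dist hv
  have h2 : Tendsto (fun j => R + s j) atTop (𝓝 (R + 0)) := tendsto_const_nhds.add hs0
  rw [add_zero] at h2
  exact le_of_tendsto_of_tendsto' h1 h2 hd

/-- **`ρ ≤ R`**: a clean window ball `closedBall (u j) ρ ⊆ Ω` (with `Ω` open and `α ∉ Ω`, e.g.
`α ∈ ∂Ω`) about points `u j` within `R + s_j` of points `v j → α` forces `ρ ≤ R`. -/
theorem rho_le_R {Ω : Set ℂ} {s : ℕ → ℝ} {u v : ℕ → ℂ} {α : ℂ} {ρ R : ℝ}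
    (hs0 : Tendsto s atTop (𝓝 0)) (hv : Tendsto v atTop (𝓝 α)) (hα : α ∉ Ω)
    (hball : ∀ j, closedBall (u j) ρ ⊆ Ω) (hd : ∀ j, dist (u j) (v j) ≤ R + s j) : ρ ≤ R := by
  refine le_of_forall_pos_lt_add fun ε hε => ?_
  have h1 : ∀ᶠ j in atTop, dist (v j) α < ε / 2 := (tendsto_iff_dist_tendsto_zero.1 hv).eventually (gt_mem_nhds (by positivity))
  have h2 : ∀ᶠ j in atTop, s j < ε / 2 := hs0.eventually (gt_mem_nhds (by positivity))
  obtain ⟨j, hj1, hj2⟩ := (h1.and h2).exists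
  have hαj : ρ < dist α (u j) := by
    by_contra hle
    push Not at hle
    exact hα (hball j (mem_closedBall.2 hle))
  rw [dist_comm] at hαj
  linarith [dist_triangle (u j) (v j) α, hd j]

/-- **The pinned window balls lie in the closure of the pinned limit domain.** -/
theorem ball_subset_closure_pinned {Ω : Set ℂ} {τj : ℕ → ℂ} {τ P : ℂ} {r : ℝ}
    (hτ : Tendsto τj atTop (𝓝 τ)) (hball : ∀ᶠ j in atTop, closedBall (P + τj j) r ⊆ Ω) :
    ball P r ⊆ closure ((fun z => z - τ) '' Ω) := by
  intro z hz
  have hmem : ∀ᶠ j in atTop, z + τj j ∈ Ω := by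
    filter_upwards [hball] with j hj
    exact hj (mem_closedBall.2 (by
      rw [dist_eq_norm, show z + τj j - (P + τj j) = z - P by ring, ← dist_eq_norm]; exact (mem_ball.1 hz).le))
  have hlim : Tendsto (fun j => z + τj j - τ) atTop (𝓝 z) := by
    have := (hτ.const_add z).sub_const τ
    rwa [add_sub_cancel_right] at this
  refine mem_closure_of_tendsto hlim (hmem.mono fun j hj => ⟨z + τj j, hj, rfl⟩)

/-- **Registered carrier `stub_carvedReduction_gateFacts`** (crux item stmt-CriticalPhenomena-10472,
stub T-A′ `stub_carvedReduction_squeezeGeometry_domains`, piece WHAT A FIRST GOOD GATE GIVES):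
`firstGoodGateN_facts` and `dist_gate_root_le`, quantified. -/
theorem stub_carvedReduction_gateFacts :
    ∀ (Ω : Set ℂ) (δ ρ R : ℝ) (N : ℕ) (S : ℕ → Set HexVertex) (c a b : HexVertex) (w : (hexDomainGraph Ω δ).Walk a b)
      (n m : ℕ) (p q : HexVertex), 0 ≤ δ → IsFirstGoodGateN Ω δ ρ R S c w.support n m p q →
      TameNestedFamily δ R N c S →
      p ∈ S n ∧ hexGraph.Adj p q ∧ closedBall ((δ : ℂ) * hexCenter q) ρ ⊆ Ω ∧
        IsFirstExitFrom (S n) w.support m p q ∧ (∀ v ∈ w.support.drop m, v ∉ S n) ∧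
        dist ((δ : ℂ) * hexCenter q) ((δ : ℂ) * hexCenter c) ≤ R + δ :=
  fun _ _ _ _ _ _ _ _ _ w _ _ _ _ hδ h hS =>
    let f := firstGoodGateN_facts w h
    ⟨f.1, f.2.1, f.2.2.1, f.2.2.2.1, f.2.2.2.2, dist_gate_root_le hδ w h hS⟩

end Summit.CriticalPhenomena.SAWScalingLimit.Theorems.ObservableToSLE.TypeLadder

end
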